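import Literature.Computability.AlgebraicComplexity.SmallFormatMatMulRankUpper
import Literature.Computability.AlgebraicComplexity.BorderRankRestriction
import HarnessLib

/-!
# From a checked integer certificate in flat format to `R_h(⟨k,m,n⟩) ≤ r` and `bR(⟨k,m,n⟩) ≤ r`

Topic `Literature/Computability/AlgebraicComplexity`; a small piece of GLUE between two tools already in
the tree, nothing specific to one tensor, everything PROVED:

* `ApproxDecompositionCertificate.lean` — `ApproxCert.check a b c r h D T U V W`, the `decide`-able
  check that integer polynomial data `U, V, W` form an order-`h` approximate decomposition
  `∑_{ρ<r} u_ρ(ε) ⊗ v_ρ(ε) ⊗ w_ρ(ε) = ε^h · (D·T) + O(ε^{h+1})` (Bläser 2013, Def. 6.1), with its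
  soundness statements `ApproxCert.approxRank_le_of_check` / `algBorderRank_le_of_check` for the FLAT
  tensor `T : Fin a → Fin b → Fin c → ℤ`;
* `SmallFormatMatMulRankUpper.lean` — `matMulFlat k m n`, the matrix multiplication tensor `⟨k,m,n⟩` in
  flat row-major format (`Fin (k·n) × Fin (k·m) × Fin (m·n)`, un-flattened by `finProdFinEquiv`), and
  the exact-rank (`h = 0`) glue `tensorRank_matMulTensor_le_of_check`.

This file adds the approximate-rank / border-rank glue: `approxRank_matMulTensor_le_of_check`
(`R_h(⟨k,m,n⟩) ≤ r`) and `algBorderRank_matMulTensor_le_of_check` (`bR(⟨k,m,n⟩) ≤ r`), over every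
commutative ring in which the multiplier `D` is a unit (relabelling by `finProdFinEquiv`:
`approxRank_precomp_le`, Bläser 2013 Thm. 6.3), a row-by-row form `ApproxCert.checkRow` of the check
(so that large certificates are evaluated by one kernel call per first-slot coordinate), and the
table accessor `ptab` for polynomial certificate data stored product-major.  Clients: the Smirnov
approximate algorithms `BorderRankMatMul244Smirnov.lean` &c.

## References

* [Blaser2013] M. Bläser, *Fast Matrix Multiplication*, Theory of Computing, Graduate Surveys 5
  (2013) — Def. 6.1 (`R_h`, border rank over `K[ε]`), Thm. 6.3(1) (invariance under permutations /
  relabelling).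
-/

noncomputable section

open scoped BigOperators Polynomial

namespace Literature.Computability.AlgebraicComplexity

namespace ApproxCert

/-- One row of `ApproxCert.check`: the entries `(i, j, l)` with the first coordinate `i` fixed.
[cite: Blaser2013, Def. 6.1] -/
def checkRow (a b c r h : ℕ) (D : ℤ) (T : Fin a → Fin b → Fin c → ℤ) (U : Fin r → Fin a → List ℤ)
    (V : Fin r → Fin b → List ℤ) (W : Fin r → Fin c → List ℤ) (i : Fin a) : Bool :=
  (List.finRange b).all fun j => (List.finRange c).all fun l =>
    lowCheck (entryPoly (h + 1) r (fun ρ => U ρ i) (fun ρ => V ρ j) (fun ρ => W ρ l)) h (D * T i j l)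

/-- `ApproxCert.check` holds as soon as every row checks (one kernel evaluation per row).
[cite: Blaser2013, Def. 6.1] -/
theorem check_of_forall_checkRow {a b c r h : ℕ} {D : ℤ} {T : Fin a → Fin b → Fin c → ℤ}
    {U : Fin r → Fin a → List ℤ} {V : Fin r → Fin b → List ℤ} {W : Fin r → Fin c → List ℤ}
    (H : ∀ i, checkRow a b c r h D T U V W i = true) : check a b c r h D T U V W = true := by
  simp only [check, List.all_eq_true]
  intro i _
  have hi := H i
  simp only [checkRow, List.all_eq_true] at hi
  exact hi

end ApproxCert

/-- Table access for polynomial certificate data stored product-major: product `ρ`, flat slot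
position `i` ↦ the ascending coefficient list (`[]` = `0` outside the table). [folklore] -/
def ptab (L : List (List (List ℤ))) {r a : ℕ} (ρ : Fin r) (i : Fin a) : List ℤ :=
  (L.getD ρ.val []).getD i.val []

/-- **From a checked order-`h` certificate for `D·⟨k,m,n⟩` in flat format to `R_h(⟨k,m,n⟩) ≤ r`**, over
every commutative ring in which `D` is a unit (`ApproxCert.approxRank_le_of_check` + un-flattening of
the three slots by `finProdFinEquiv`, `approxRank_precomp_le`). [cite: Blaser2013, Def. 6.1 and Thm. 6.3(1)] -/
theorem approxRank_matMulTensor_le_of_check (K : Type*) [CommRing K] {k m n r h : ℕ} {D : ℤ}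
    {U : Fin r → Fin (k * n) → List ℤ} {V : Fin r → Fin (k * m) → List ℤ}
    {W : Fin r → Fin (m * n) → List ℤ}
    (hc : ApproxCert.check (k * n) (k * m) (m * n) r h D (matMulFlat k m n) U V W = true)
    (hD : IsUnit ((D : ℤ) : K)) : approxRank h (matMulTensor K k m n) ≤ r := by
  have hflat := ApproxCert.approxRank_le_of_check K hc hD
  have e : (fun a b c => (fun i j l => ((matMulFlat k m n i j l : ℤ) : K))
      (finProdFinEquiv a) (finProdFinEquiv b) (finProdFinEquiv c)) = matMulTensor K k m n := by
    funext a b c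
    simp only [matMulFlat, Equiv.symm_apply_apply, matMulTensor]
    split_ifs <;> simp
  rw [← e]
  exact (approxRank_precomp_le h (fun i j l => ((matMulFlat k m n i j l : ℤ) : K))
    finProdFinEquiv finProdFinEquiv finProdFinEquiv).trans hflat

/-- **From a checked order-`h` certificate for `D·⟨k,m,n⟩` in flat format to `bR(⟨k,m,n⟩) ≤ r`**, over
every commutative ring in which `D` is a unit. [cite: Blaser2013, Def. 6.1 and Thm. 6.3(1)] -/
theorem algBorderRank_matMulTensor_le_of_check (K : Type*) [CommRing K] {k m n r h : ℕ} {D : ℤ}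
    {U : Fin r → Fin (k * n) → List ℤ} {V : Fin r → Fin (k * m) → List ℤ}
    {W : Fin r → Fin (m * n) → List ℤ}
    (hc : ApproxCert.check (k * n) (k * m) (m * n) r h D (matMulFlat k m n) U V W = true)
    (hD : IsUnit ((D : ℤ) : K)) : algBorderRank (matMulTensor K k m n) ≤ r :=
  (algBorderRank_le_approxRank h _).trans (approxRank_matMulTensor_le_of_check K hc hD)

end Literature.Computability.AlgebraicComplexity

end
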